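import Mathlib
import Summits.AtomisticToContinuum.HydrodynamicLimit.Theorems.OneFlightGossipEngineOneFlightLayeredChaosKickEvent
import HarnessLib

/-!
# `OneFlightGossipEngine.OneFlightLayeredChaos` — the flight starts and the coarse past of the `n`-th collision
are measurable on the good set (crux stmt-AtomisticToContinuum-14535, helper for every line)

`flightStart G ε γ 0 k t = sSup (insert 0 (collision times of k in (0, t)))` (a finite set on a good orbit), taken at
the data-dependent time `t = Φ.nthCollisionTimeOf i n z` and, for the partner, at the data-dependent particle index
`k = Φ.nthPartnerOf i n z`. On the good set `flightStart < c` iff `0 < c` and no collision of `k` in `[c, t)`, a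
countable condition in the events "collision of `k` in `[c, q]`" and `{q < t_n}` (files `…WindowEvent`,
`…CollisionTime`); the partner index takes finitely many values (file `…KickEvent`). With the joint measurability of
the flow on `Φ.good × ℝ` this makes the crux's generating map `z ↦ (Φ.coarsePastOf (coarseCell r) i n z,
Φ.nthPartnerOf i n z)` measurable on `Φ.good` — the input of `exists_measurable_version_of_comap_event`
(file `…JunkInvisibility`): every event of the crux's σ-algebra `𝒢` has a measurable version with the same trace
outer measures. No new definitions.
-/

open MeasureTheory Set Filter Topology
open Literature.Analysis.FluidPDE

namespace Summit.AtomisticToContinuum.HydrodynamicLimit.Theorems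

variable {d : Type*} [Fintype d] {N : ℕ} {ε : ℝ}

/-- On a good orbit: the flight start of `k` before time `t` is `< c` iff `0 < c` and `k` has no collision in
`[c, t)` (with `0 < ·` automatic). [folklore] -/
theorem flightStart_lt_iff (Φ : HardSphereFlow (Torus.geometry d) ε N) (k : Fin N)
    {z : Config N d (UnitAddTorus d)} (hz : z ∈ Φ.good) (t c : ℝ) :
    flightStart (Torus.geometry d) ε (fun s => Φ.flow s z) 0 k t < c ↔
      0 < c ∧ ∀ s, Participates (Torus.geometry d) ε (Φ.flow s z) k → 0 < s → s < t → s < c := by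
  set S := collisionTimesOf (Torus.geometry d) ε (fun s => Φ.flow s z) k with hS
  have hfin : (S ∩ Ioo 0 t).Finite := (Φ.isTrajectory z hz).finite_collisionTimesOf_inter_Ioo k 0 t
  have hfin' : (insert 0 (S ∩ Ioo 0 t)).Finite := hfin.insert 0
  have hbdd : BddAbove (insert 0 (S ∩ Ioo 0 t)) := hfin'.bddAbove
  have hmem : flightStart (Torus.geometry d) ε (fun s => Φ.flow s z) 0 k t ∈ insert 0 (S ∩ Ioo 0 t) :=
    flightStart_mem hfin
  constructor
  · intro h
    refine ⟨lt_of_le_of_lt (le_flightStart hfin) h, fun s hs h0 hst => ?_⟩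
    exact lt_of_le_of_lt (le_csSup hbdd (mem_insert_of_mem 0 ⟨hs, h0, hst⟩)) h
  · rintro ⟨hc, hall⟩
    rcases mem_insert_iff.1 hmem with h0 | ⟨hs, h0s, hst⟩
    · rw [h0]; exact hc
    · exact hall _ hs h0s hst

/-- Measurability on the good set of `z ↦ flightStart (orbit of z) 0 k (T z)` from that of `T` (sublevel events of
`T` on the good set). [folklore] -/
theorem measurableSet_good_inter_flightStart_lt (Φ : HardSphereFlow (Torus.geometry d) ε N) (k : Fin N)
    {T : Config N d (UnitAddTorus d) → ℝ} (hT : ∀ c : ℝ, MeasurableSet (Φ.good ∩ {z | T z ≤ c})) (c : ℝ) :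
    MeasurableSet (Φ.good ∩ {z : Config N d (UnitAddTorus d) |
      flightStart (Torus.geometry d) ε (fun s => Φ.flow s z) 0 k (T z) < c}) := by
  -- {q < T} on the good set
  have hgt : ∀ q : ℝ, MeasurableSet (Φ.good ∩ {z | q < T z}) := by
    intro q
    have : Φ.good ∩ {z | q < T z} = Φ.good \ (Φ.good ∩ {z | T z ≤ q}) := by
      ext z; simp only [mem_inter_iff, mem_setOf_eq, Set.mem_sdiff, not_and, not_le]; tauto
    rw [this]; exact Φ.measurableSet_good.diff (hT q)
  -- "a collision of k in [c, T z)"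
  have hbefore : MeasurableSet (Φ.good ∩ {z : Config N d (UnitAddTorus d) |
      ∃ s, Participates (Torus.geometry d) ε (Φ.flow s z) k ∧ c ≤ s ∧ s < T z}) := by
    have : Φ.good ∩ {z : Config N d (UnitAddTorus d) |
        ∃ s, Participates (Torus.geometry d) ε (Φ.flow s z) k ∧ c ≤ s ∧ s < T z} =
      ⋃ q : ℚ, ((Φ.good ∩ {z | (q : ℝ) < T z}) ∩ (Φ.good ∩ {z : Config N d (UnitAddTorus d) |
        ∃ t ∈ Icc c (q : ℝ), Participates (Torus.geometry d) ε (Φ.flow t z) k})) := by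
      ext z
      simp only [mem_inter_iff, mem_setOf_eq, mem_iUnion]
      constructor
      · rintro ⟨hz, s, hs, hcs, hsT⟩
        obtain ⟨q, hq1, hq2⟩ := exists_rat_btwn hsT
        exact ⟨q, ⟨hz, hq2⟩, hz, s, ⟨hcs, hq1.le⟩, hs⟩
      · rintro ⟨q, ⟨hz, hq⟩, _, s, ⟨hcs, hsq⟩, hs⟩
        exact ⟨hz, s, hs, hcs, hsq.trans_lt hq⟩
    rw [this]
    exact MeasurableSet.iUnion fun q =>
      (hgt q).inter (measurableSet_good_inter_exists_participates_Icc Φ k c q)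
  by_cases hc : 0 < c
  · have hrepr : Φ.good ∩ {z : Config N d (UnitAddTorus d) |
        flightStart (Torus.geometry d) ε (fun s => Φ.flow s z) 0 k (T z) < c} =
      Φ.good \ (Φ.good ∩ {z : Config N d (UnitAddTorus d) |
        ∃ s, Participates (Torus.geometry d) ε (Φ.flow s z) k ∧ c ≤ s ∧ s < T z}) := by
      ext z
      simp only [mem_inter_iff, mem_setOf_eq, Set.mem_sdiff, not_and, not_exists]
      constructor
      · rintro ⟨hz, h⟩
        refine ⟨hz, fun _ s hs hcs hsT => ?_⟩
        have := ((flightStart_lt_iff Φ k hz (T z) c).1 h).2 s hs (hc.trans_le hcs) hsT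
        linarith
      · rintro ⟨hz, hno⟩
        refine ⟨hz, (flightStart_lt_iff Φ k hz (T z) c).2 ⟨hc, fun s hs _ hsT => ?_⟩⟩
        by_contra hsc
        exact hno hz s hs (not_lt.1 hsc) hsT
    rw [hrepr]
    exact Φ.measurableSet_good.diff hbefore
  · have : Φ.good ∩ {z : Config N d (UnitAddTorus d) |
        flightStart (Torus.geometry d) ε (fun s => Φ.flow s z) 0 k (T z) < c} = ∅ := by
      ext z
      simp only [mem_inter_iff, mem_setOf_eq, mem_empty_iff_false, iff_false, not_and, not_lt]
      intro hz
      exact (not_lt.1 hc).trans (le_flightStart ((Φ.isTrajectory z hz).finite_collisionTimesOf_inter_Ioo k 0 _))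
    rw [this]; exact MeasurableSet.empty

/-- The flight start of a FIXED particle `k` before the `n`-th collision time of `i`, restricted to the good set,
is measurable. [folklore] -/
theorem measurable_flightStart_nthCollisionTimeOf_restrict (Φ : HardSphereFlow (Torus.geometry d) ε N)
    (i k : Fin N) (n : ℕ) :
    Measurable fun z : Φ.good => flightStart (Torus.geometry d) ε
      (fun s => Φ.flow s (z : Config N d (UnitAddTorus d))) 0 k
      (Φ.nthCollisionTimeOf i n (z : Config N d (UnitAddTorus d))) := by
  refine measurable_of_Iio fun c => ?_
  have : (fun z : Φ.good => flightStart (Torus.geometry d) ε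
      (fun s => Φ.flow s (z : Config N d (UnitAddTorus d))) 0 k
      (Φ.nthCollisionTimeOf i n (z : Config N d (UnitAddTorus d)))) ⁻¹' Iio c =
    Subtype.val ⁻¹' (Φ.good ∩ {z : Config N d (UnitAddTorus d) |
      flightStart (Torus.geometry d) ε (fun s => Φ.flow s z) 0 k (Φ.nthCollisionTimeOf i n z) < c}) := by
    ext z
    simp only [mem_preimage, mem_Iio, mem_inter_iff, mem_setOf_eq, Subtype.coe_prop, true_and]
  rw [this]
  have hset : MeasurableSet (Φ.good ∩ {z : Config N d (UnitAddTorus d) |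
      flightStart (Torus.geometry d) ε (fun s => Φ.flow s z) 0 k (Φ.nthCollisionTimeOf i n z) < c}) :=
    measurableSet_good_inter_flightStart_lt Φ k (T := fun z => Φ.nthCollisionTimeOf i n z)
      (measurableSet_good_inter_nthCollisionTimeOf_le Φ i n) c
  exact measurable_subtype_coe hset

/-- The flight start of the (data-dependent) PARTNER before the `n`-th collision time of `i`, restricted to the good
set, is measurable. [folklore] -/
theorem measurable_flightStart_partner_restrict (Φ : HardSphereFlow (Torus.geometry d) ε N) (i : Fin N) (n : ℕ) :
    Measurable fun z : Φ.good => flightStart (Torus.geometry d) ε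
      (fun s => Φ.flow s (z : Config N d (UnitAddTorus d))) 0
      (Φ.nthPartnerOf i n (z : Config N d (UnitAddTorus d)))
      (Φ.nthCollisionTimeOf i n (z : Config N d (UnitAddTorus d))) := by
  -- all N flight starts at once, then evaluate at the (measurable, finitely-valued) partner index
  have hf : Measurable fun z : Φ.good => fun k : Fin N => flightStart (Torus.geometry d) ε
      (fun s => Φ.flow s (z : Config N d (UnitAddTorus d))) 0 k
      (Φ.nthCollisionTimeOf i n (z : Config N d (UnitAddTorus d))) :=
    measurable_pi_lambda _ fun k => measurable_flightStart_nthCollisionTimeOf_restrict Φ i k n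
  have heval : Measurable fun p : (Fin N → ℝ) × Fin N => p.1 p.2 :=
    measurable_from_prod_countable_left fun k => measurable_pi_apply k
  exact heval.comp (hf.prodMk (measurable_nthPartnerOf_restrict Φ i n))

/-- **The crux's generating map is measurable on the good set**: for every mesh `r`,
`z ↦ (Φ.coarsePastOf (coarseCell r) i n z, Φ.nthPartnerOf i n z)` restricted to `Φ.good` is measurable (into the
product/pi measurable structure the crux's `comap … inferInstance` uses). [folklore] -/
theorem measurable_coarsePastOf_nthPartnerOf_restrict : ∀ {d : Type*} [Fintype d] {N : ℕ} {ε : ℝ} (Φ : Literature.Analysis.FluidPDE.HardSphereFlow (Literature.Analysis.FluidPDE.Torus.geometry d) ε N) (r : ℝ) (i : Fin N) (n : ℕ), Measurable fun z : Φ.good => (Φ.coarsePastOf (Literature.Analysis.FluidPDE.Torus.coarseCell r) i n (z : Literature.Analysis.FluidPDE.Config N d (UnitAddTorus d)), Φ.nthPartnerOf i n (z : Literature.Analysis.FluidPDE.Config N d (UnitAddTorus d))) := by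
  intro d _ N ε Φ r i n
  have hq : Measurable (coarseConfig (N := N) (d := d) (Torus.coarseCell (d := d) r)) :=
    measurable_coarseConfig (Torus.measurable_coarseCell r)
  have h1 : Measurable fun z : Φ.good => Φ.flow (flightStart (Torus.geometry d) ε
      (fun s => Φ.flow s (z : Config N d (UnitAddTorus d))) 0 i
      (Φ.nthCollisionTimeOf i n (z : Config N d (UnitAddTorus d)))) (z : Config N d (UnitAddTorus d)) :=
    Φ.measurable_flow_prod_torus.comp
      (measurable_id.prodMk (measurable_flightStart_nthCollisionTimeOf_restrict Φ i i n))
  have h2 : Measurable fun z : Φ.good => Φ.flow (flightStart (Torus.geometry d) ε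
      (fun s => Φ.flow s (z : Config N d (UnitAddTorus d))) 0
      (Φ.nthPartnerOf i n (z : Config N d (UnitAddTorus d)))
      (Φ.nthCollisionTimeOf i n (z : Config N d (UnitAddTorus d)))) (z : Config N d (UnitAddTorus d)) :=
    Φ.measurable_flow_prod_torus.comp (measurable_id.prodMk (measurable_flightStart_partner_restrict Φ i n))
  exact ((hq.comp h1).prodMk (hq.comp h2)).prodMk (measurable_nthPartnerOf_restrict Φ i n)

end Summit.AtomisticToContinuum.HydrodynamicLimit.Theorems
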